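import Summits.QuantumFields.BalabanUV.T4Continuum.Spine.NE2.ComposedRemainderGaugeTowerRegular
import Summits.QuantumFields.BalabanUV.T4Continuum.Spine.NE2.TorusAveragedTowerPlaquette

/-!
# T⁴ programme, spine node NE2 (U1a) — R14 W3d + F6 (ζ), THE HOOKUP: THE END FOR COHERENT AVERAGED TOWERS OF UNITARY GAUGE FIELDS — the per-level plaquette letters DERIVED from the
# finest level's letter by [B7] Prop. 1 on the torus (cell `pub-balaban-gaps`, seat ne2 gen 7; after `ComposedRemainderGaugeTowerRegular` and `TorusAveragedTowerPlaquette`)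

`ComposedRemainderGaugeTowerRegular.composed_full_averaging_rate_of_regularGaugeTowers` displays a plaquette letter `p_{k,i} ≤ p_U/L^{2i}` at EVERY level `i` of every tower `U k`.  In print the
levels ARE the successive (15)-averages of the finest field `U_k`, and the letters follow from the finest one by [B7] Prop. 1 (51) — on the route's torus carriers this is
`TorusAveragedTowerPlaquette.tplaq_tower_le`.  THIS FILE makes the hookup:
 * **`liftU u hu`** — a tower of SITE-BASED unitary bond configurations `u k i : Tor (fine (lev L i) M) → Fin d → (M_n(ℂ))ˣ` read on the END's 1-form carriers (`U k i ν (x, μ) := u k i x ν`,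
   independent of the component index `μ` — the `liftR` convention of ROOT B); `fundT_liftU`;
 * `val_inv_eq_conjTranspose`, **`tplaq_val`** (the torus plaquette holonomy of unitary data as the matrix `V_ν(x)V_μ(x+e_ν)V_ν(x+e_μ)ᴴV_μ(x)ᴴ`) and **`comm_letter_of_tplaq`**: the ENDs'
   COMMUTATOR-form letter `‖V_ν(x)V_μ(x+e_ν) − V_μ(x)V_ν(x+e_μ)‖` IS the holonomy-form letter `‖u(∂p) − 1‖` (`OneStepLoopHolonomy.norm_plaq_comm_eq`; the diagonal `ν = μ` vanishes);
 * **`composed_full_averaging_rate_of_coherentTowers`** — the (3.26)-shape END with print's composed averaging + (124)'s remainders for COHERENT towers `u k i = V̄[u k (i+1)]` (`i < k`,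
   `TorusBlockAveragePlaquette.bavgTor`): the plaquette hypotheses are now ONLY the finest level's letter `‖u_k^{(k)}(∂p) − 1‖ ≤ p_U·(L⁻²)^k` and the numerical thresholds `8·C₀′·p_U ≤ 1`,
   `d·(2p_U) ≤ 1/16`; every other binder as in `…_of_regularGaugeTowers` (sizes `α_U`, top-level Lipschitz `β_U`, chain closeness `σ_U, θ_c`, `Y_x ∈ P`, the frame, NE3 BY NAME, `P₄`, `ρ`, ONE
   closed-form smallness inequality with `p_U ↦ 2p_U`);
 * **`composed_full_averaging_rate_of_coherentTowers_flat`** — non-vacuity: the flat tower is coherent (`coherent_flat`) and satisfies every binder.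
REMAINS (located, unchanged in class): the size/closeness letters of the averaged tower are (3.35)-gauge information (NE3's currency — G2), (W2″), (R7).
HONEST FRAMING (T4-DAG p. 1).  A COMPOSITION of kernel theorems about MODEL objects; `u`, `P₄`, the frame are DATA asserted by nobody (NOT Bałaban's minimiser); NE3 OPEN by name; nothing of
Bałaban's asserted beyond print; NOT NE2, NOT [B9] (3.16)/(3.26) or [B7] (51)/(124)/(143) as printed; **NE2 (U1a) NOT PROVED**; spine PROVED 0/9 unchanged; NOT continuum YM / infinite volume /
mass gap / Clay.  HONEST DEPENDENCY: continuum YM on T⁴ ⇐ BetaPertH ∧ nine spine estimates (0/9 proved).  No `sorry`.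
-/

noncomputable section

open scoped BigOperators ComplexConjugate Matrix Matrix.Norms.L2Operator Kronecker
open Finset (range)

namespace Summit.QuantumFields.BalabanUV.T4Continuum.NE2.ComposedRemainderCoherentTower

open Literature.MathematicalPhysics.QuantumFieldTheory.Balaban1983to89.B5Prop11Plancherel (Tor fine unitVec Cst)
open Literature.MathematicalPhysics.QuantumFieldTheory.Balaban1983to89.B5G183RateUnitTower (lev lev_neZero)
open Literature.MathematicalPhysics.QuantumFieldTheory.Balaban1983to89.T4EtaRateMin (LocalRate)
open Literature.MathematicalPhysics.QuantumFieldTheory.Balaban1983to89.B7Prop1Explicit (U1 mem_U1)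
open Summit.QuantumFields.BalabanUV.Beta.AdjointCarrierWiringEnd (CompFamily)
open Summit.QuantumFields.BalabanUV.T4Continuum
open Summit.QuantumFields.BalabanUV.T4Continuum.BalabanAveragedTowerUnit (idx Qlev)
open Summit.QuantumFields.BalabanUV.T4Continuum.BlockPairingGeometry (tau)
open Summit.QuantumFields.BalabanUV.T4Continuum.KingPairingPlantedLaw (JpcT calDalev CJ)
open Summit.QuantumFields.BalabanUV.T4Continuum.GramPerturbationLaw (C2gram)
open Summit.QuantumFields.BalabanUV.T4Continuum.CovariantAveragingTower (TowerLimitRate)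
open Summit.QuantumFields.BalabanUV.T4Continuum.BackgroundResolventTower (PerturbationLaws Cpert)
open Summit.QuantumFields.BalabanUV.T4Continuum.PerturbationAlgebra (perturbationLaws_zero perturbationLaws_mono)
open Summit.QuantumFields.BalabanUV.T4Continuum.RegularBackgroundTower (RegularTransporters regClass betaNE3)
open Summit.QuantumFields.BalabanUV.T4Continuum.ColourCovariantLaplacian (kappaCol)
open Summit.QuantumFields.BalabanUV.T4Continuum.NE2FromNE3 (bgReadings)
open Summit.QuantumFields.BalabanUV.T4Continuum.CovariantAveragingSummand (kappaQ)
open Summit.QuantumFields.BalabanUV.T4Continuum.NE2BalabanLayer (tierBPert kappaB C2B)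
open Summit.QuantumFields.BalabanUV.T4Continuum.NE2BalabanFlatWitness (localRate_flat)
open Summit.QuantumFields.BalabanUV.T4Continuum.NE2.CovariantTableBalaban (TBal)
open Summit.QuantumFields.BalabanUV.T4Continuum.NE2.ComposedAveragingMean (thetaZero)
open Summit.QuantumFields.BalabanUV.T4Continuum.NE2.ComposedAveragingRemainder (avgPertFull)
open Summit.QuantumFields.BalabanUV.T4Continuum.NE2.ComposedRemainderTower (Erem cR)
open Summit.QuantumFields.BalabanUV.T4Continuum.NE2.OneStepLoopHolonomy (norm_plaq_comm_eq)
open Summit.QuantumFields.BalabanUV.T4Continuum.CovariantLineSlotExp (norm_le_one_of_mem_unitary)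
open Summit.QuantumFields.BalabanUV.T4Continuum.NE2.OneStepRemainderLoopCoeff (YxT remCoeffOf)
open Summit.QuantumFields.BalabanUV.T4Continuum.NE2.OneStepRemainderLoopFlat (YxT_one)
open Summit.QuantumFields.BalabanUV.T4Continuum.NE2.ComposedRemainderGaugeTower (fundT adT)
open Summit.QuantumFields.BalabanUV.T4Continuum.NE2.ComposedRemainderGaugeTowerFlat (flatU fundT_flatU)
open Summit.QuantumFields.BalabanUV.T4Continuum.NE2.ComposedRemainderRateLetters (GamU EU CrU)
open Summit.QuantumFields.BalabanUV.T4Continuum.NE2.ComposedRemainderGaugeTowerRegular (topAdT topAdT_flat composed_full_averaging_rate_of_regularGaugeTowers)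
open Summit.QuantumFields.BalabanUV.T4Continuum.NE2.TorusBlockAveragePlaquette (bavgTor tplaq)
open Summit.QuantumFields.BalabanUV.T4Continuum.NE2.TorusAveragedTowerPlaquette (C0' tplaq_tower_le coherent_flat)

variable {d : ℕ} (L : ℕ) [NeZero L] (M : Fin d → ℕ) [hM : ∀ μ, NeZero (M μ)]
  {n : Type} [Fintype n] [DecidableEq n] {ι : Type} [Fintype ι] [DecidableEq ι] {c : ℝ} {P : Submodule ℝ (Matrix n n ℂ)} {e : ι → Matrix n n ℂ}
  (hF : CompFamily c P e) (a : ℝ) (ha : 0 < a) [Nonempty n] [Nonempty ι]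

/-! ## §1 Site-based unitary towers read on the END's carriers; the two currencies of the plaquette letter -/

/-- a tower of SITE-BASED unitary bond configurations read on the 1-form carriers of the END: `U k i ν (x, μ) := u k i x ν` (independent of `μ`). [folklore] -/
def liftU (u : ℕ → (i : ℕ) → Tor (fine (lev L i) M) → Fin d → (Matrix n n ℂ)ˣ) (hu : ∀ k i y κ, ((u k i y κ : (Matrix n n ℂ)ˣ) : Matrix n n ℂ) ∈ Matrix.unitaryGroup n ℂ) :
    ℕ → (i : ℕ) → Fin d → (idx L M i → Matrix.unitaryGroup n ℂ) := fun k i ν b => ⟨(u k i b.1 ν : Matrix n n ℂ), hu k i b.1 ν⟩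

omit [NeZero L] hM [Nonempty n] in
/-- the fundamental reading of `liftU`. [folklore] -/
theorem fundT_liftU (u : ℕ → (i : ℕ) → Tor (fine (lev L i) M) → Fin d → (Matrix n n ℂ)ˣ) (hu : ∀ k i y κ, ((u k i y κ : (Matrix n n ℂ)ˣ) : Matrix n n ℂ) ∈ Matrix.unitaryGroup n ℂ)
    (k i : ℕ) (ν : Fin d) (x : Tor (fine (lev L i) M)) (μ : Fin d) : fundT L M (liftU L M u hu k) i ν (x, μ) = (u k i x ν : Matrix n n ℂ) := rfl

omit [Nonempty n] in
/-- the inverse of a unitary unit is its conjugate transpose. [folklore] -/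
theorem val_inv_eq_conjTranspose {w : (Matrix n n ℂ)ˣ} (hw : (w : Matrix n n ℂ) ∈ Matrix.unitaryGroup n ℂ) : ((w⁻¹ : (Matrix n n ℂ)ˣ) : Matrix n n ℂ) = (w : Matrix n n ℂ)ᴴ := by
  rw [← Matrix.star_eq_conjTranspose]
  exact Units.inv_eq_of_mul_eq_one_right (Matrix.mem_unitaryGroup_iff.mp hw)

omit [Nonempty n] in
/-- **the torus plaquette holonomy of unitary data as a matrix**: `u(∂p) = u_ν(x)u_μ(x+e_ν)u_ν(x+e_μ)ᴴu_μ(x)ᴴ`. [folklore] -/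
theorem tplaq_val {Q : Fin d → ℕ} (w : Tor Q → Fin d → (Matrix n n ℂ)ˣ) (hw : ∀ y κ, ((w y κ : (Matrix n n ℂ)ˣ) : Matrix n n ℂ) ∈ Matrix.unitaryGroup n ℂ) (x : Tor Q) (ν μ : Fin d) :
    ((tplaq w x ν μ : (Matrix n n ℂ)ˣ) : Matrix n n ℂ)
      = (w x ν : Matrix n n ℂ) * (w (x + unitVec Q ν) μ : Matrix n n ℂ) * ((w (x + unitVec Q μ) ν : Matrix n n ℂ))ᴴ * ((w x μ : Matrix n n ℂ))ᴴ := by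
  unfold tplaq
  rw [Units.val_mul, Units.val_mul, Units.val_mul, val_inv_eq_conjTranspose (hw _ _), val_inv_eq_conjTranspose (hw _ _)]

/-- unitary matrices are contractive units (`U1`). [folklore] -/
theorem mem_U1_of_unitary {w : (Matrix n n ℂ)ˣ} (hw : (w : Matrix n n ℂ) ∈ Matrix.unitaryGroup n ℂ) : w ∈ U1 (Matrix n n ℂ) := by
  rw [mem_U1]
  refine ⟨norm_le_one_of_mem_unitary hw, ?_⟩
  rw [val_inv_eq_conjTranspose hw, ← Matrix.star_eq_conjTranspose]
  exact norm_le_one_of_mem_unitary (Unitary.star_mem hw)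

omit [NeZero L] hM [Nonempty n] in
/-- **THE COMMUTATOR-FORM LETTER OF THE ENDs FROM THE HOLONOMY-FORM LETTER**: on the fundamental reading of `liftU` at level `i+1`, the ENDs' hypothesis `hp` is the torus plaquette
letter of `u k (i+1)` (`ν ≠ μ`; the diagonal `ν = μ` vanishes). [cite: Balaban1985Averaging, (44) p.24, (109) p.34 (shape)] [folklore] -/
theorem comm_letter_of_tplaq (u : ℕ → (i : ℕ) → Tor (fine (lev L i) M) → Fin d → (Matrix n n ℂ)ˣ) (hu : ∀ k i y κ, ((u k i y κ : (Matrix n n ℂ)ˣ) : Matrix n n ℂ) ∈ Matrix.unitaryGroup n ℂ)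
    {q : ℕ → ℕ → ℝ} (hq0 : ∀ k i, 0 ≤ q k i) (hq : ∀ k i (y : Tor (fine (lev L i) M)) (ν μ : Fin d), ν ≠ μ → ‖((tplaq (u k i) y ν μ : (Matrix n n ℂ)ˣ) : Matrix n n ℂ) - 1‖ ≤ q k i)
    (k i : ℕ) (x : Tor (fine (L * lev L i) M)) (ν μ : Fin d) :
    ‖fundT L M (liftU L M u hu k) (i + 1) ν (x, μ) * fundT L M (liftU L M u hu k) (i + 1) μ (x + unitVec (fine (L * lev L i) M) ν, μ)
        - fundT L M (liftU L M u hu k) (i + 1) μ (x, μ) * fundT L M (liftU L M u hu k) (i + 1) ν (x + unitVec (fine (L * lev L i) M) μ, μ)‖ ≤ q k (i + 1) := by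
  by_cases hνμ : ν = μ
  · subst hνμ; rw [sub_self, norm_zero]; exact hq0 k (i + 1)
  have key : ‖fundT L M (liftU L M u hu k) (i + 1) ν (x, μ) * fundT L M (liftU L M u hu k) (i + 1) μ (x + unitVec (fine (L * lev L i) M) ν, μ)
        - fundT L M (liftU L M u hu k) (i + 1) μ (x, μ) * fundT L M (liftU L M u hu k) (i + 1) ν (x + unitVec (fine (L * lev L i) M) μ, μ)‖
      = ‖((tplaq (u k (i + 1)) x ν μ : (Matrix n n ℂ)ˣ) : Matrix n n ℂ) - 1‖ := by
    rw [tplaq_val (u k (i + 1)) (hu k (i + 1)) x ν μ]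
    exact norm_plaq_comm_eq (L * lev L i) M (V := fun ν' b => (u k (i + 1) b.1 ν' : Matrix n n ℂ)) μ (fun ν' b => hu k (i + 1) b.1 ν') x ν
  rw [key]; exact hq k (i + 1) x ν μ hνμ

/-! ## §2 The END for coherent averaged towers -/

omit [Nonempty n] in
/-- the flat configuration has trivial plaquette holonomies. [folklore] -/
theorem tplaq_one {Q : Fin d → ℕ} (x : Tor Q) (ν μ : Fin d) : tplaq (fun (_ : Tor Q) (_ : Fin d) => (1 : (Matrix n n ℂ)ˣ)) x ν μ = 1 := by
  unfold tplaq; simp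

/-- **THE PER-LEVEL PLAQUETTE LETTERS OF A COHERENT TOWER** (junk levels above the top flat): `‖u_k^{(i)}(∂p) − 1‖ ≤ 2p_U·(L⁻²)^i` at EVERY `i`, from the top letter, coherence below the top
(`tplaq_tower_le`) and flatness above it. [cite: Balaban1985Averaging, Prop. 1 (51) p.26 (iterated)] [folklore] -/
theorem letters_of_coherent (hL : 2 ≤ L) {u : ℕ → (i : ℕ) → Tor (fine (lev L i) M) → Fin d → (Matrix n n ℂ)ˣ}
    (hu : ∀ k i y κ, ((u k i y κ : (Matrix n n ℂ)ˣ) : Matrix n n ℂ) ∈ Matrix.unitaryGroup n ℂ)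
    (hcoh : ∀ k i, i < k → u k i = bavgTor (lev L i) L M (u k (i + 1))) (hjunk : ∀ k i, k < i → u k i = fun _ _ => 1)
    {pU : ℝ} (hpU : 0 ≤ pU) (hth : 8 * C0' d * pU ≤ 1)
    (htop : ∀ k (y : Tor (fine (lev L k) M)) (μ ν : Fin d), μ ≠ ν → ‖((tplaq (u k k) y μ ν : (Matrix n n ℂ)ˣ) : Matrix n n ℂ) - 1‖ ≤ pU * (((L : ℝ)⁻¹) ^ 2) ^ k)
    (k i : ℕ) (y : Tor (fine (lev L i) M)) {ν μ : Fin d} (hνμ : ν ≠ μ) :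
    ‖((tplaq (u k i) y ν μ : (Matrix n n ℂ)ˣ) : Matrix n n ℂ) - 1‖ ≤ 2 * pU * (((L : ℝ)⁻¹) ^ 2) ^ i := by
  rcases le_or_gt i k with hik | hik
  · exact tplaq_tower_le L M hL k (u k) (fun i y κ => mem_U1_of_unitary (hu k i y κ)) (hcoh k) hpU hth (htop k) hik y hνμ
  · rw [hjunk k i hik, tplaq_one, Units.val_one, sub_self, norm_zero]
    have h0 : (0 : ℝ) ≤ (L : ℝ)⁻¹ := inv_nonneg.mpr (Nat.cast_nonneg L)
    positivity

/-- **THE (3.26)-SHAPE END WITH THE FULL LINEARISED COMPOSED AVERAGING FOR COHERENT AVERAGED TOWERS OF UNITARY GAUGE FIELDS**: `composed_full_averaging_rate_of_regularGaugeTowers` for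
`U := liftU u`, the towers `u k` COHERENT below their top (`u k i = V̄[u k (i+1)]`, `i < k`, Bałaban's (15)/(42) on the torus) and flat above it (junk convention `u k i = 1`, `i > k`), with the
per-level plaquette letters `p_{k,i} := 2p_U·(L⁻²)^i` PROVED from the finest level's letter (`letters_of_coherent` + `comm_letter_of_tplaq`).  Displayed: coherence/junk, the TOP plaquette
letter `p_U` with `8·C₀′·p_U ≤ 1` and `d·(2p_U) ≤ 1/16`, sizes `α_U`, top-level Lipschitz `β_U`, chain closeness `σ_U, θ_c`, `Y_x ∈ P`, the frame, NE3 BY NAME, `P₄`, `ρ`, ONE closed-form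
smallness inequality.
[cite: Balaban1985BackgroundPropagators, (3.3) p.390, (3.15)–(3.16) p.393, (3.26) p.395, (3.35) p.396; Balaban1985Averaging, (15) p.19, (42) p.23, Prop. 1 (51) p.26, (114) p.34, (124)–(126) p.36, (139)–(143) p.39; King1986, Lemma 4.5 (4.38) p.674 (method)] [folklore] -/
theorem composed_full_averaging_rate_of_coherentTowers (hL : 2 ≤ L) (hd : 1 ≤ d)
    {u : ℕ → (i : ℕ) → Tor (fine (lev L i) M) → Fin d → (Matrix n n ℂ)ˣ} (hu : ∀ k i y κ, ((u k i y κ : (Matrix n n ℂ)ˣ) : Matrix n n ℂ) ∈ Matrix.unitaryGroup n ℂ)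
    (hcoh : ∀ k i, i < k → u k i = bavgTor (lev L i) L M (u k (i + 1))) (hjunk : ∀ k i, k < i → u k i = fun _ _ => 1)
    {αU βU σU θc ρ pU : ℝ} (hαU : 0 ≤ αU) (hβU : 0 ≤ βU) (hσU : 0 ≤ σU) (hθ0 : 0 ≤ θc) (hθ1 : θc ≤ 1) (hθρ : θc ≤ ρ) (hρ : 3 / (2 * (L : ℝ)) ≤ ρ) (hρ1 : ρ < 1)
    (hpU : 0 ≤ pU) (hth : 8 * C0' d * pU ≤ 1) (hpUs : d * (2 * pU) ≤ 1 / 16)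
    (htop : ∀ k (y : Tor (fine (lev L k) M)) (μ ν : Fin d), μ ≠ ν → ‖((tplaq (u k k) y μ ν : (Matrix n n ℂ)ˣ) : Matrix n n ℂ) - 1‖ ≤ pU * (((L : ℝ)⁻¹) ^ 2) ^ k)
    (hUa : ∀ k i ν b, ‖(liftU L M u hu k i ν b : Matrix n n ℂ) - 1‖ ≤ αU / (lev L i : ℕ))
    (hUb : ∀ k ν μ (b : idx L M k), ‖(liftU L M u hu k k ν (tau (fine (lev L k) M) μ b) : Matrix n n ℂ) - (liftU L M u hu k k ν b : Matrix n n ℂ)‖ ≤ βU / ((lev L k : ℕ) : ℝ) ^ 2)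
    (hUc : ∀ k i ν b, i ≤ k → ‖(liftU L M u hu (k + 1) i ν b : Matrix n n ℂ) - (liftU L M u hu k i ν b : Matrix n n ℂ)‖ ≤ σU * θc ^ k / (lev L i : ℕ))
    {C : ℝ} (hC : 0 ≤ C) (hNE3 : LocalRate (bgReadings L M (regClass L M (topAdT L M hF (liftU L M u hu)))) C ((L : ℝ)⁻¹))
    (hYP : ∀ k i x μ r, YxT L M (fundT L M (liftU L M u hu k)) i x μ r ∈ P)
    {P₄ : (k : ℕ) → Matrix (idx L M k × ι) (idx L M k × ι) ℂ} {κ₄ C₄ : ℝ}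
    (hP₄ : PerturbationLaws (fun k => calDalev L M a ha k ⊗ₖ (1 : Matrix ι ι ℂ)) P₄ (fun k => JpcT L M k ⊗ₖ (1 : Matrix ι ι ℂ)) κ₄ (fun k => C₄ * ρ ^ k))
    (hsmall : kappaB ι d a (2 * αU) (2 * βU) C (kappaQ d a (a : ℂ) (Fintype.card ι * (Real.exp ((((d + 1) * L : ℕ) : ℝ) * (2 * αU)) - 1)
      + (1 + Fintype.card ι * (Real.exp ((((d + 1) * L : ℕ) : ℝ) * (2 * αU)) - 1)) * cR d L ι * GamU d (2 * pU) * Real.exp (EU ι d L αU (2 * pU)))) κ₄ < 1) :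
    TowerLimitRate (fun k => Qlev L M k ⊗ₖ (1 : Matrix ι ι ℂ)) ((L : ℝ) ^ d)
      (fun k => (calDalev L M a ha k ⊗ₖ (1 : Matrix ι ι ℂ)
        + tierBPert L M (topAdT L M hF (liftU L M u hu)) (avgPertFull L M a (fun k => TBal L M (adT L M hF (liftU L M u hu k)) k)
            (fun k => Erem L M (adT L M hF (liftU L M u hu k)) (remCoeffOf L M (fundT L M (liftU L M u hu k)) c e (adT L M hF (liftU L M u hu k))) k)) P₄ k)⁻¹)
      (Cpert (kappaB ι d a (2 * αU) (2 * βU) C (kappaQ d a (a : ℂ) (Fintype.card ι * (Real.exp ((((d + 1) * L : ℕ) : ℝ) * (2 * αU)) - 1)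
          + (1 + Fintype.card ι * (Real.exp ((((d + 1) * L : ℕ) : ℝ) * (2 * αU)) - 1)) * cR d L ι * GamU d (2 * pU) * Real.exp (EU ι d L αU (2 * pU)))) κ₄) (2 * d * Cst d a) (CJ d a)
        (C2B ι d L a (2 * αU) (2 * βU) C
          (a * C2gram (Cst d a) 1 (Fintype.card ι * (Real.exp ((((d + 1) * L : ℕ) : ℝ) * (2 * αU)) - 1)
              + (1 + Fintype.card ι * (Real.exp ((((d + 1) * L : ℕ) : ℝ) * (2 * αU)) - 1)) * cR d L ι * GamU d (2 * pU) * Real.exp (EU ι d L αU (2 * pU))) (2 * d * Cst d a) (CJ d a) (Cst d a)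
            (Cst d a * Fintype.card ι * (thetaZero d L (2 * αU) (2 * σU) + (Real.exp ((((d + 1) * L : ℕ) : ℝ) * (2 * αU)) - 1)) + CrU ι d L a αU σU (2 * pU))) C₄) 0 1) ρ := by
  have h0 : (0 : ℝ) ≤ (L : ℝ)⁻¹ := inv_nonneg.mpr (Nat.cast_nonneg L)
  have hq : ∀ k i (y : Tor (fine (lev L i) M)) (ν μ : Fin d), ν ≠ μ → ‖((tplaq (u k i) y ν μ : (Matrix n n ℂ)ˣ) : Matrix n n ℂ) - 1‖ ≤ 2 * pU * (((L : ℝ)⁻¹) ^ 2) ^ i :=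
    fun k i y ν μ hνμ => letters_of_coherent L M hL hu hcoh hjunk hpU hth htop k i y hνμ
  exact composed_full_averaging_rate_of_regularGaugeTowers L M hF a ha hL hd (U := liftU L M u hu) hαU hβU hσU hθ0 hθ1 hθρ hρ hρ1 hUa hUb hUc hC hNE3
    (p := fun _ i => 2 * pU * (((L : ℝ)⁻¹) ^ 2) ^ i) (fun _ i => by positivity)
    (fun k i x ν μ => comm_letter_of_tplaq L M u hu (q := fun _ i => 2 * pU * (((L : ℝ)⁻¹) ^ 2) ^ i) (fun _ i => by positivity) hq k i x ν μ)
    (pU := 2 * pU) (by positivity) (fun _ i => le_of_eq (by rw [pow_mul])) hpUs hYP hP₄ hsmall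

/-! ## §3 Non-vacuity at the flat tower -/

omit [NeZero L] hM [Nonempty n] in
/-- the flat site-based tower reads as the flat tower `flatU` of file 9. [folklore] -/
theorem liftU_one (h : ∀ k i (y : Tor (fine (lev L i) M)) (κ : Fin d), (((fun (_ : ℕ) (i : ℕ) (_ : Tor (fine (lev L i) M)) (_ : Fin d) => (1 : (Matrix n n ℂ)ˣ)) k i y κ : (Matrix n n ℂ)ˣ) : Matrix n n ℂ) ∈ Matrix.unitaryGroup n ℂ) :
    liftU L M (fun (_ : ℕ) (i : ℕ) (_ : Tor (fine (lev L i) M)) (_ : Fin d) => (1 : (Matrix n n ℂ)ˣ)) h = fun _ => flatU L M := by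
  funext k i ν b
  exact Subtype.ext rfl

include ha in
/-- **NON-VACUITY**: the flat site-based tower (`u ≡ 1`) is coherent (`coherent_flat`), flat above every top, has trivial plaquettes, zero letters, and satisfies NE3's shape and the smallness
inequality with `C = κ₄ = 0`, `P₄ = 0`; so every displayed binder of `composed_full_averaging_rate_of_coherentTowers` holds, for any component family, `L ≥ 2`, `d ≥ 1`, `3/(2L) ≤ ρ < 1`.
NOT a statement about non-trivial data; NE2 NOT proved. [folklore] -/
theorem composed_full_averaging_rate_of_coherentTowers_flat (hL : 2 ≤ L) (hd : 1 ≤ d) {ρ : ℝ} (hρ : 3 / (2 * (L : ℝ)) ≤ ρ) (hρ1 : ρ < 1) :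
    ∃ (u : ℕ → (i : ℕ) → Tor (fine (lev L i) M) → Fin d → (Matrix n n ℂ)ˣ) (hu : ∀ k i y κ, ((u k i y κ : (Matrix n n ℂ)ˣ) : Matrix n n ℂ) ∈ Matrix.unitaryGroup n ℂ) (Cp : ℝ),
      (∀ k i, i < k → u k i = bavgTor (lev L i) L M (u k (i + 1))) ∧
      TowerLimitRate (fun k => Qlev L M k ⊗ₖ (1 : Matrix ι ι ℂ)) ((L : ℝ) ^ d)
        (fun k => (calDalev L M a ha k ⊗ₖ (1 : Matrix ι ι ℂ)
          + tierBPert L M (topAdT L M hF (liftU L M u hu)) (avgPertFull L M a (fun k => TBal L M (adT L M hF (liftU L M u hu k)) k)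
              (fun k => Erem L M (adT L M hF (liftU L M u hu k)) (remCoeffOf L M (fundT L M (liftU L M u hu k)) c e (adT L M hF (liftU L M u hu k))) k)) (fun _ => 0) k)⁻¹) Cp ρ := by
  have hρ0 : 0 ≤ ρ := le_trans (by positivity) hρ
  set u : ℕ → (i : ℕ) → Tor (fine (lev L i) M) → Fin d → (Matrix n n ℂ)ˣ := fun _ _ _ _ => 1 with hudef
  have hu : ∀ k i y κ, ((u k i y κ : (Matrix n n ℂ)ˣ) : Matrix n n ℂ) ∈ Matrix.unitaryGroup n ℂ := fun _ _ _ _ => by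
    show (((1 : (Matrix n n ℂ)ˣ)) : Matrix n n ℂ) ∈ Matrix.unitaryGroup n ℂ
    rw [Units.val_one]; exact Submonoid.one_mem _
  have hcoh : ∀ k i, i < k → u k i = bavgTor (lev L i) L M (u k (i + 1)) := fun k i hik => coherent_flat L M k i hik
  have hlift : liftU L M u hu = fun _ => flatU L M := liftU_one L M hu
  have hone : ∀ (k i : ℕ) (ν : Fin d) (b : idx L M i), ((liftU L M u hu k i ν b : Matrix.unitaryGroup n ℂ) : Matrix n n ℂ) = 1 := fun _ _ _ _ => rfl
  have hP₄ : PerturbationLaws (fun k => calDalev L M a ha k ⊗ₖ (1 : Matrix ι ι ℂ)) (fun k => (0 : Matrix (idx L M k × ι) (idx L M k × ι) ℂ))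
      (fun k => JpcT L M k ⊗ₖ (1 : Matrix ι ι ℂ)) 0 (fun k => (0 : ℝ) * ρ ^ k) :=
    perturbationLaws_mono perturbationLaws_zero le_rfl fun k => le_of_eq (by ring)
  have hexp : Real.exp ((((d + 1) * L : ℕ) : ℝ) * (2 * 0)) - 1 = 0 := by rw [mul_zero, mul_zero, Real.exp_zero, sub_self]
  have hG : GamU d (2 * 0) = 0 := by unfold GamU; rw [mul_zero, mul_zero]
  have hsmall : kappaB ι d a (2 * 0) (2 * 0) 0 (kappaQ d a (a : ℂ) (Fintype.card ι * (Real.exp ((((d + 1) * L : ℕ) : ℝ) * (2 * 0)) - 1)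
      + (1 + Fintype.card ι * (Real.exp ((((d + 1) * L : ℕ) : ℝ) * (2 * 0)) - 1)) * cR d L ι * GamU d (2 * 0) * Real.exp (EU ι d L 0 (2 * 0)))) 0 < 1 := by
    rw [hexp, hG, mul_zero]
    simp [kappaB, kappaCol, kappaQ, betaNE3]
  have hNE3 : LocalRate (bgReadings L M (regClass L M (topAdT L M hF (liftU L M u hu)))) 0 ((L : ℝ)⁻¹) := by
    rw [hlift, topAdT_flat]; exact localRate_flat L M le_rfl (inv_nonneg.mpr (Nat.cast_nonneg L))
  have hC0 : 0 ≤ C0' d := by unfold C0'; positivity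
  refine ⟨u, hu, _, hcoh, composed_full_averaging_rate_of_coherentTowers L M hF a ha hL hd hu hcoh (fun _ _ _ => rfl) (αU := 0) (βU := 0) (σU := 0) (θc := 0) (pU := 0)
    le_rfl le_rfl le_rfl le_rfl zero_le_one hρ0 hρ hρ1 le_rfl (by rw [mul_zero]; norm_num) (by rw [mul_zero, mul_zero]; norm_num)
    (fun k y μ ν _ => by
      have e1 : ((tplaq (u k k) y μ ν : (Matrix n n ℂ)ˣ) : Matrix n n ℂ) = 1 := by rw [hudef, tplaq_one, Units.val_one]
      rw [e1, sub_self, norm_zero]; positivity)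
    (fun _ _ _ _ => by rw [hone, sub_self, norm_zero]; positivity) (fun _ _ _ _ => by rw [hone, hone, sub_self, norm_zero]; positivity)
    (fun _ _ _ _ _ => by rw [hone, hone, sub_self, norm_zero]; positivity) le_rfl hNE3
    (fun _ i x μ r => by rw [hlift, fundT_flatU, YxT_one]; exact P.zero_mem) hP₄ hsmall⟩

end Summit.QuantumFields.BalabanUV.T4Continuum.NE2.ComposedRemainderCoherentTower

end
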